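import Summits.CriticalPhenomena.PercolationContinuityZ3.Theorems.PercNearOneGluingNoHeavyLowerTailSahiThreeCopyTwoPointCertsK4

/-!
# Sahi's three-function conjecture — FLOW-FORM sandwich certificates: a checker without the pair loop

Infrastructure for certificate theorems on `{0,1}^k` at `k ≥ 5` (companion of `…TwoPointFast`, `…TwoPointCertsK4`).
The sandwich facts `(N1), (N2) ≥ 0` of the two-point reduction (`tc_frontFn_nonneg_of_facts`) are statements
`1_Vᵀ K 1_W ≥ 0` for ALL pairs of up-sets `V, W` of codes; at `k = 4` they were checked by enumerating the `168²` pairs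
(`certOKfast2`), which is out of reach at `k = 5` (`7581²` pairs per certificate).  Here the checker instead verifies a
FLOW-FORM decomposition (memo FROM-prim-sahi-p1-gen59 §11(l)): the `(N1)` diagonal and the `(N2)` kernel dominate, entrywise,
nonnegative combinations of products `a bᵀ` of HALL GENERATORS `a, b ∈ D = {δ_x} ∪ {δ_y − δ_x : x ≤ y}` of the dual cone of
up-set indicators; since `Σ_{x ∈ V} a(x) ≥ 0` for every up-set `V` and every `a ∈ D` (`partSum_nonneg`), the facts follow for
ALL up-sets with no enumeration (`facts_of_certOKflow`).  The decomposition is DATA (found by LP), the checker only verifies it.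

* `partVal lo hi` — the generator `δ_hi − δ_lo` (`lo < hi`) or `δ_lo` (`lo = hi`) as an integer function of the code;
  `partSum_nonneg` — its sum over an up-closed family is `≥ 0` when `lo ≤ hi` bitwise.
* `certOKflow S A F tab nu lam` — `S·θ ≥ 0`; every generator valid (`LeC lo hi`); the `(N1)` diagonal minus `Σ c·a` and the
  `(N2)` kernel minus `Σ c·a bᵀ` are entrywise `≥ 0`; all coefficients `c ≥ 0`.
* ★ `facts_of_certOKflow` — the rational facts `θ ≥ 0`, `(N1), (N2) ≥ 0` on `upSetsC k × upSetsC k`; hence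
  `tc_frontFn_nonneg_of_certOKflow` (3C for the free slot `1_A ∘ front` against everything, via `tc_frontFn_nonneg_of_facts`)
  and the relabelled form `tc_frontFn_nonneg_of_certOKflow_relab`.
Nothing conjectural is used; no `sorry`; standard axioms. [this work]
-/

namespace Summit.CriticalPhenomena.PercolationContinuityZ3.Theorems.SahiThreeCopy

open Finset Function Literature.Combinatorics.Sahi2008
open scoped BigOperators

section Flow

variable {k : ℕ}

/-- The Hall generator attached to a pair of codes: `δ_hi − δ_lo` if `lo ≠ hi`, the point mass `δ_lo` if `lo = hi`. [this work] -/
def partVal (lo hi x : Fin (2 ^ k)) : ℤ :=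
  if lo = hi then (if x = lo then 1 else 0) else ((if x = hi then 1 else 0) - (if x = lo then 1 else 0))

/-- A generator pair is VALID when `lo ≤ hi` coordinatewise. [this work] -/
def partOK (lo hi : Fin (2 ^ k)) : Bool := decide (LeC lo hi)

/-- ★ Hall generators are nonnegative on up-closed families: `Σ_{x ∈ V} (δ_hi − δ_lo)(x) ≥ 0` for `lo ≤ hi`. [this work] -/
theorem partSum_nonneg {V : Finset (Fin (2 ^ k))} (hV : UpClosedC V) {lo hi : Fin (2 ^ k)} (h : partOK lo hi = true) :
    0 ≤ ∑ x ∈ V, partVal lo hi x := by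
  unfold partOK at h
  rw [decide_eq_true_eq] at h
  unfold partVal
  by_cases hlh : lo = hi
  · simp only [hlh, if_true]
    exact Finset.sum_nonneg fun x _ => by split_ifs <;> norm_num
  · simp only [hlh, if_false, Finset.sum_sub_distrib, Finset.sum_ite_eq', sub_nonneg]
    by_cases hlo : lo ∈ V
    · rw [if_pos hlo, if_pos (hV lo hlo hi h)]
    · rw [if_neg hlo]; split_ifs <;> norm_num

/-- One `(N1)` flow term `(c, lo, hi)`: `c · (δ_hi − δ_lo)` (or `c·δ_lo`). [this work] -/
def nuVal (t : ℕ × ℕ × ℕ) (x : Fin (2 ^ k)) : ℤ :=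
  (t.1 : ℤ) * partVal (Fin.ofNat (2 ^ k) t.2.1) (Fin.ofNat (2 ^ k) t.2.2) x

/-- One `(N2)` flow term `(c, lo₁, hi₁, lo₂, hi₂)`: `c · a(x) · b(y)`. [this work] -/
def lamVal (t : ℕ × ℕ × ℕ × ℕ × ℕ) (x y : Fin (2 ^ k)) : ℤ :=
  (t.1 : ℤ) * (partVal (Fin.ofNat (2 ^ k) t.2.1) (Fin.ofNat (2 ^ k) t.2.2.1) x *
    partVal (Fin.ofNat (2 ^ k) t.2.2.2.1) (Fin.ofNat (2 ^ k) t.2.2.2.2) y)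

/-- Validity of an `(N1)` term: in-range codes and `lo ≤ hi`. [this work] -/
def nuOK (k : ℕ) (t : ℕ × ℕ × ℕ) : Bool :=
  decide (t.2.1 < 2 ^ k) && decide (t.2.2 < 2 ^ k) && partOK (Fin.ofNat (2 ^ k) t.2.1) (Fin.ofNat (2 ^ k) t.2.2)

/-- Validity of an `(N2)` term. [this work] -/
def lamOK (k : ℕ) (t : ℕ × ℕ × ℕ × ℕ × ℕ) : Bool :=
  decide (t.2.1 < 2 ^ k) && decide (t.2.2.1 < 2 ^ k) && decide (t.2.2.2.1 < 2 ^ k) && decide (t.2.2.2.2 < 2 ^ k) &&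
    partOK (Fin.ofNat (2 ^ k) t.2.1) (Fin.ofNat (2 ^ k) t.2.2.1) && partOK (Fin.ofNat (2 ^ k) t.2.2.2.1) (Fin.ofNat (2 ^ k) t.2.2.2.2)

/-- Accumulate the `(N2)` terms into a `2^k × 2^k` integer table (one pass over the terms). [this work] -/
def lamTable (k : ℕ) (lam : List (ℕ × ℕ × ℕ × ℕ × ℕ)) : Vector (Vector ℤ (2 ^ k)) (2 ^ k) :=
  Vector.ofFn fun x => Vector.ofFn fun y => (lam.map fun t => lamVal t x y).sum

/-- Accumulate the `(N1)` terms. [this work] -/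
def nuTable (k : ℕ) (nu : List (ℕ × ℕ × ℕ)) : Vector ℤ (2 ^ k) :=
  Vector.ofFn fun x => (nu.map fun t => nuVal t x).sum

/-- ★ The flow-form certificate check (scale `S`) with an EXTRA kernel table `X` (any bilinear form known to be nonnegative on
pairs of up-sets; `X = 0` for the pure flow form): `S·θ ≥ 0`; terms valid; the `(N1)` diagonal dominates the declared transports
and the `(N2)` kernel dominates the declared products plus `X`, entrywise. [this work] -/
def certOKflowX (S : ℕ) (A : Finset (Fin (2 ^ k) × Fin (2 ^ k) × Fin (2 ^ k))) (F : Finset (Fin (2 ^ k))) (tab : Array ℤ)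
    (nu : List (ℕ × ℕ × ℕ)) (lam : List (ℕ × ℕ × ℕ × ℕ × ℕ)) (X : Vector (Vector ℤ (2 ^ k)) (2 ^ k)) : Bool :=
  let d1 := diag1 S A F tab
  let K2 := kmat2 S A F tab
  let T1 := nuTable k nu
  let T2 := lamTable k lam
  decide (∀ x : Fin (2 ^ k), 0 ≤ thetaZ tab x) && nu.all (nuOK k) && lam.all (lamOK k) &&
    decide (∀ x : Fin (2 ^ k), T1[x] ≤ d1.getD (x : ℕ) 0) &&
    decide (∀ x : Fin (2 ^ k), ∀ y : Fin (2 ^ k), (T2[x])[y] + (X[x])[y] ≤ (K2[x])[y])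

/-- The zero table. [this work] -/
def zeroTable (k : ℕ) : Vector (Vector ℤ (2 ^ k)) (2 ^ k) := Vector.ofFn fun _ => Vector.ofFn fun _ => 0

/-- The pure flow-form check (`X = 0`). [this work] -/
def certOKflow (S : ℕ) (A : Finset (Fin (2 ^ k) × Fin (2 ^ k) × Fin (2 ^ k))) (F : Finset (Fin (2 ^ k))) (tab : Array ℤ)
    (nu : List (ℕ × ℕ × ℕ)) (lam : List (ℕ × ℕ × ℕ × ℕ × ℕ)) : Bool :=
  certOKflowX S A F tab nu lam (zeroTable k)


/-- Exchanging a finite sum with a sum over a list of terms (plumbing). [folklore] -/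
theorem sum_list_map_comm {α β : Type*} (s : Finset α) (L : List β) (g : β → α → ℤ) :
    ∑ x ∈ s, (L.map fun t => g t x).sum = (L.map fun t => ∑ x ∈ s, g t x).sum := by
  induction L with
  | nil => simp
  | cons t L ih => simp only [List.map_cons, List.sum_cons, Finset.sum_add_distrib, ih]

/-- A valid `(N1)` term has nonnegative sum over every up-closed family. [this work] -/
theorem nuVal_sum_nonneg {V : Finset (Fin (2 ^ k))} (hV : UpClosedC V) {t : ℕ × ℕ × ℕ} (ht : nuOK k t = true) :
    0 ≤ ∑ x ∈ V, nuVal t x := by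
  unfold nuOK at ht
  simp only [Bool.and_eq_true, decide_eq_true_eq] at ht
  unfold nuVal
  rw [← Finset.mul_sum]
  exact mul_nonneg (by exact_mod_cast Nat.zero_le _) (partSum_nonneg hV ht.2)

/-- A valid `(N2)` term has nonnegative double sum over every pair of up-closed families. [this work] -/
theorem lamVal_sum_nonneg {V W : Finset (Fin (2 ^ k))} (hV : UpClosedC V) (hW : UpClosedC W) {t : ℕ × ℕ × ℕ × ℕ × ℕ}
    (ht : lamOK k t = true) : 0 ≤ ∑ x ∈ V, ∑ y ∈ W, lamVal t x y := by
  unfold lamOK at ht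
  simp only [Bool.and_eq_true, decide_eq_true_eq] at ht
  obtain ⟨⟨_, h1⟩, h2⟩ := ht
  unfold lamVal
  have : ∑ x ∈ V, ∑ y ∈ W, (t.1 : ℤ) * (partVal (Fin.ofNat (2 ^ k) t.2.1) (Fin.ofNat (2 ^ k) t.2.2.1) x *
      partVal (Fin.ofNat (2 ^ k) t.2.2.2.1) (Fin.ofNat (2 ^ k) t.2.2.2.2) y) =
      (t.1 : ℤ) * ((∑ x ∈ V, partVal (Fin.ofNat (2 ^ k) t.2.1) (Fin.ofNat (2 ^ k) t.2.2.1) x) *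
        ∑ y ∈ W, partVal (Fin.ofNat (2 ^ k) t.2.2.2.1) (Fin.ofNat (2 ^ k) t.2.2.2.2) y) := by
    rw [Finset.sum_mul_sum, Finset.mul_sum]
    simp only [Finset.mul_sum]
  rw [this]
  exact mul_nonneg (by exact_mod_cast Nat.zero_le _) (mul_nonneg (partSum_nonneg hV h1) (partSum_nonneg hW h2))

/-- Membership in `upSetsC k` is up-closedness. [this work] -/
theorem upClosedC_of_mem {V : Finset (Fin (2 ^ k))} (hV : V ∈ upSetsC k) : UpClosedC V := by
  simpa [upSetsC] using hV

/-- ★ Unpacking the flow-form check (with an extra kernel `X` nonnegative on up-set pairs) into the rational facts `θ ≥ 0`,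
`(N1), (N2) ≥ 0` on all pairs of up-closed families. [this work] -/
theorem facts_of_certOKflowX {S : ℕ} (hS : 0 < S) {A : Finset (Fin (2 ^ k) × Fin (2 ^ k) × Fin (2 ^ k))}
    {F : Finset (Fin (2 ^ k))} {tab : Array ℤ} {nu : List (ℕ × ℕ × ℕ)} {lam : List (ℕ × ℕ × ℕ × ℕ × ℕ)}
    {X : Vector (Vector ℤ (2 ^ k)) (2 ^ k)} (hX : ∀ V ∈ upSetsC k, ∀ W ∈ upSetsC k, 0 ≤ ∑ x ∈ V, ∑ y ∈ W, (X[x])[y])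
    (h : certOKflowX S A F tab nu lam X = true) :
    (∀ x : Fin (2 ^ k), 0 ≤ thetaC (tabQof S k tab) x) ∧
      (∀ V ∈ upSetsC k, ∀ W ∈ upSetsC k, 0 ≤ N1C A F (tabQof S k tab) V W ∧ 0 ≤ N2C A F (tabQof S k tab) V W) := by
  unfold certOKflowX at h
  simp only [Bool.and_eq_true, decide_eq_true_eq, List.all_eq_true] at h
  obtain ⟨⟨⟨⟨hθ, hnu⟩, hlam⟩, hd⟩, hK⟩ := h
  have hSq : (0 : ℚ) < S := by exact_mod_cast hS
  refine ⟨fun x => ?_, fun V hV W hW => ⟨?_, ?_⟩⟩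
  · rw [thetaC_tabQof]; exact div_nonneg (by exact_mod_cast hθ x) hSq.le
  · -- (N1): the diagonal over `V ∩ W` dominates the declared transports
    have hVW : UpClosedC (V ∩ W) := upClosedC_of_mem (inter_mem_upSetsC hV hW)
    have h1 : (0 : ℤ) ≤ ∑ x ∈ V ∩ W, N1Z S A F tab {x} {x} := by
      have hle : ∑ x ∈ V ∩ W, (nuTable k nu)[x] ≤ ∑ x ∈ V ∩ W, N1Z S A F tab {x} {x} :=
        Finset.sum_le_sum fun x _ => (hd x).trans_eq (diag1_getD S A F tab x)
      refine le_trans ?_ hle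
      simp only [nuTable, Fin.getElem_fin, Vector.getElem_ofFn, Fin.eta]
      rw [sum_list_map_comm]
      exact List.sum_nonneg (by
        intro v hv
        rw [List.mem_map] at hv
        obtain ⟨t, ht, rfl⟩ := hv
        exact nuVal_sum_nonneg hVW (hnu t ht))
    have h1c : (0 : ℚ) ≤ ((∑ x ∈ V ∩ W, N1Z S A F tab {x} {x} : ℤ) : ℚ) := by exact_mod_cast h1
    rw [Int.cast_sum] at h1c
    have h1' : (0 : ℚ) ≤ S * N1C A F (tabQof S k tab) V W := by
      rw [N1C_eq_sum_inter, Finset.mul_sum]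
      exact h1c.trans_eq (Finset.sum_congr rfl fun x _ => cast_N1Z hS A F tab {x} {x})
    exact (mul_nonneg_iff_of_pos_left hSq).1 h1'
  · -- (N2): the kernel dominates the declared products of Hall generators
    have hVu : UpClosedC V := upClosedC_of_mem hV
    have hWu : UpClosedC W := upClosedC_of_mem hW
    have h2 : (0 : ℤ) ≤ ∑ x ∈ V, ∑ y ∈ W, N2Z S A F tab {x} {y} := by
      have hle : ∑ x ∈ V, ∑ y ∈ W, (((lamTable k lam)[x])[y] + (X[x])[y]) ≤ ∑ x ∈ V, ∑ y ∈ W, N2Z S A F tab {x} {y} :=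
        Finset.sum_le_sum fun x _ => Finset.sum_le_sum fun y _ => (hK x y).trans_eq (by
          simp only [kmat2, Fin.getElem_fin, Vector.getElem_ofFn, Fin.eta])
      refine le_trans ?_ hle
      simp only [Finset.sum_add_distrib]
      refine add_nonneg ?_ (hX V hV W hW)
      simp only [lamTable, Fin.getElem_fin, Vector.getElem_ofFn, Fin.eta]
      have hx : ∀ x ∈ V, ∑ y ∈ W, (lam.map fun t => lamVal t x y).sum = (lam.map fun t => ∑ y ∈ W, lamVal t x y).sum :=
        fun x _ => sum_list_map_comm W lam (fun t y => lamVal t x y)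
      rw [Finset.sum_congr rfl hx, sum_list_map_comm]
      exact List.sum_nonneg (by
        intro v hv
        rw [List.mem_map] at hv
        obtain ⟨t, ht, rfl⟩ := hv
        exact lamVal_sum_nonneg hVu hWu (hlam t ht))
    have h2c : (0 : ℚ) ≤ ((∑ x ∈ V, ∑ y ∈ W, N2Z S A F tab {x} {y} : ℤ) : ℚ) := by exact_mod_cast h2
    rw [Int.cast_sum] at h2c
    have h2' : (0 : ℚ) ≤ S * N2C A F (tabQof S k tab) V W := by
      rw [N2C_eq_sum_singleton, Finset.mul_sum]
      refine h2c.trans_eq (Finset.sum_congr rfl fun x _ => ?_)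
      rw [Int.cast_sum, Finset.mul_sum]
      exact Finset.sum_congr rfl fun y _ => cast_N2Z hS A F tab {x} {y}
    exact (mul_nonneg_iff_of_pos_left hSq).1 h2'

/-- The zero table is (trivially) nonnegative on pairs. [this work] -/
theorem zeroTable_sum_nonneg (V W : Finset (Fin (2 ^ k))) : 0 ≤ ∑ x ∈ V, ∑ y ∈ W, ((zeroTable k)[x])[y] :=
  Finset.sum_nonneg fun x _ => Finset.sum_nonneg fun y _ => by simp [zeroTable, Fin.getElem_fin, Vector.getElem_ofFn]

/-- ★ The pure flow form: facts from `certOKflow`. [this work] -/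
theorem facts_of_certOKflow {S : ℕ} (hS : 0 < S) {A : Finset (Fin (2 ^ k) × Fin (2 ^ k) × Fin (2 ^ k))}
    {F : Finset (Fin (2 ^ k))} {tab : Array ℤ} {nu : List (ℕ × ℕ × ℕ)} {lam : List (ℕ × ℕ × ℕ × ℕ × ℕ)}
    (h : certOKflow S A F tab nu lam = true) :
    (∀ x : Fin (2 ^ k), 0 ≤ thetaC (tabQof S k tab) x) ∧
      (∀ V ∈ upSetsC k, ∀ W ∈ upSetsC k, 0 ≤ N1C A F (tabQof S k tab) V W ∧ 0 ≤ N2C A F (tabQof S k tab) V W) :=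
  facts_of_certOKflowX hS (fun V _ W _ => zeroTable_sum_nonneg V W) h

/-- ★ From a passing flow-form certificate to 3C for the free slot `1_A ∘ front` against everything. [this work] -/
theorem tc_frontFn_nonneg_of_certOKflow (π : Fin k → ℕ) (A : Finset (Pt k)) {S : ℕ} (hS : 0 < S) {tab : Array ℤ}
    {nu : List (ℕ × ℕ × ℕ)} {lam : List (ℕ × ℕ × ℕ × ℕ × ℕ)}
    (h : certOKflow S (arrSetC π) (A.map (codeE k).toEmbedding) tab nu lam = true)
    {d : ℕ} (b : Fin d → ℕ) {G H : Pt (d + k) → ℝ} (hG : ∀ w, 0 ≤ G w) (hH : ∀ w, 0 ≤ H w) (hGm : Monotone G) (hHm : Monotone H) :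
    0 ≤ tc (appendProf k π b) (frontFn k (setInd A)) G H :=
  tc_frontFn_nonneg_of_facts π A (tabQof S k tab) (facts_of_certOKflow hS h).1 (facts_of_certOKflow hS h).2 b hG hH hGm hHm

/-- ★ The same for every relabelling `(π₀ ∘ σ, σ·A₀)` of a certified `(π₀, A₀)`. [this work] -/
theorem tc_frontFn_nonneg_of_certOKflow_relab (σ : Equiv.Perm (Fin k)) (π₀ : Fin k → ℕ) (A₀ : Finset (Pt k)) {S : ℕ}
    (hS : 0 < S) {tab : Array ℤ} {nu : List (ℕ × ℕ × ℕ)} {lam : List (ℕ × ℕ × ℕ × ℕ × ℕ)}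
    (h : certOKflow S (arrSetC π₀) (A₀.map (codeE k).toEmbedding) tab nu lam = true)
    {π : Fin k → ℕ} (hπ : π = π₀ ∘ σ) {A : Finset (Pt k)} (hA : A = A₀.map (relab σ).toEmbedding)
    {d : ℕ} (b : Fin d → ℕ) {G H : Pt (d + k) → ℝ} (hG : ∀ w, 0 ≤ G w) (hH : ∀ w, 0 ≤ H w) (hGm : Monotone G) (hHm : Monotone H) :
    0 ≤ tc (appendProf k π b) (frontFn k (setInd A)) G H :=
  tc_frontFn_nonneg_of_relab σ π₀ A₀ (tabQof S k tab) (facts_of_certOKflow hS h).1 (facts_of_certOKflow hS h).2 hπ hA b hG hH hGm hHm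

end Flow

end Summit.CriticalPhenomena.PercolationContinuityZ3.Theorems.SahiThreeCopy
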